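import Mathlib
import Literature.Analysis.FluidPDE.TypeIAncientMild
import Literature.Analysis.FluidPDE.TypeIAncientMildRescale
import Literature.Analysis.FluidPDE.SpaceTimeCalculus
import Literature.Analysis.FluidPDE.SwirlTransportProofs
import Literature.Analysis.FluidPDE.AxisymmetricVorticityTransport
import Literature.Analysis.FluidPDE.WeakSolution
import Summits.NavierStokesRegularity.NavierStokesRegularity.Theses.SymmetryModuliCount
import Summits.NavierStokesRegularity.NavierStokesRegularity.Theorems.PoloidalWindowDoorPoloidalWindowRigidityNearIdentityDefs
import Summits.NavierStokesRegularity.NavierStokesRegularity.Theorems.SymmetryModuliCountSymmetricLiouville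
import Summits.NavierStokesRegularity.NavierStokesRegularity.Theorems.SymmetryModuliCountSymmetricLiouvilleRotationCovariance
import Summits.NavierStokesRegularity.NavierStokesRegularity.Theorems.SymmetryModuliCountAxisymEndLiouvilleStubAxisNormalForm

/-!
# Crux `PoloidalWindowRigidity` (K2, stmt-NavierStokesRegularity-19708) — LINE 30 `point_group`, ANNEX 3 `point_group_rss` (0 sorry)
# (IDEATOR seat ns-idea-8, generation 13; v1.2): CLASS-LEVEL H1 ≡ THE REGISTERED OPEN CORE OF ANOTHER ROUTE'S CRUX (PROVED `↔`), and H1 inherits its far-field theorem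

v1.2 HEADLINE (§5–§6, PROVED, 0 sorry): `noScrewSolitonClass_iff_rssLiouville : NoScrewSolitonClass ↔ RssLiouville` — the generator clause
INTEGRATES back to the screw-scaling group along every orbit (`screwSoliton_of_clause`, ODE uniqueness via the group law `orbitVal_add`), and a
general skew axis is conjugated to the vertical one (`clause_conj`, tree `exists_conj_eq_smul_rotGen` + `isTypeIAncientMild_conj_linearIsometryEquiv`).
So «no rotating scaling soliton in A_C, any speed α ≠ 0, any axis/centre» IS EXACTLY `Disproof.RotatedSelfSimilarLiouville` = the `hRSS` of
`Theorems.SymmetryModuliCountSymmetricLiouville.spiralScalingLiouville_of_rss` (the open core of stmt-NavierStokesRegularity-4053): attacking H1 at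
class level is attacking that core; the column's H1 is strictly BELOW it only through e₂-poloidality + the pin.

BY-NAME WIRING (everything PROVED; the research statements enter only as hypotheses):

* `clause_of_screwSoliton` — THE GENERATOR OF A ROTATING SCALING SOLITON (PROVED): if a field `w`, jointly `C¹` on the open past,
  is a one-parameter screw-scaling soliton about the vertical axis through the origin, `IsScrew (α σ) (e^σ) w` for every `σ`
  (objects of `Theorems/…NearIdentityDefs`, critic R1: IMPORTED, not inlined), then it is annihilated by the rotated scaling
  generator `∇w·(x + Ax) + w + 2t ∂ₜw − Aw = 0` with `A = α • J` (`J = rotGenL`), i.e. it carries EXACTLY the symmetry clause of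
  the crux `Theses.SymmetryModuliCount.SymmetricLiouville` (stmt-NavierStokesRegularity-4053) with `ξ = (0, 1, αJ)`.
* `NoScrewSolitonClass` — the CLASS-LEVEL form of LINE 29/30's hand H1 (no rotating scaling soliton in `A_C` at any speed
  `α ≠ 0`, any vertical axis); LINE 30's pinned `NoPinnedScrewSoliton` follows from it in two lines (`class_of_pinned`,
  `pinned_absurd_of_zero`; recorded in `point_group.lean` v1.1 as `noPinnedScrewSoliton_of_class`).
* `noScrewSolitonClass_of_rss` — H1 (class level) ⇐ the bounded-profile ROTATED-SELF-SIMILAR LIOUVILLE statement `hRSS` (verbatim the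
  hypothesis of `Theorems.SymmetryModuliCountSymmetricLiouville.spiralScalingLiouville_of_rss` = `Cruxes/SymmetricLiouville/Disproof.
  RotatedSelfSimilarLiouville`, the registered open core of stmt-4053; Pineau–Vicol Conj. 1.1 / Tsai 2018 Conj. 8.9 territory);
  `noScrewSolitonClass_of_core` — ⇐ the NARROWED core `hCore` (RSS Liouville for elements small far from the centre,
  `…rotatedSelfSimilarLiouville_of_core`); `noScrewSolitonClass_of_symmetricLiouville` — ⇐ the crux stmt-4053 BY NAME.
* `screwSoliton_farField` — FREE DATUM FOR H1 (PROVED, unconditional): the profile of any screw-scaling soliton of `A_C` (any speed,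
  `α = 0` allowed) VANISHES AT INFINITY in the scale-invariant sense, `√(−t)‖v(t, c + x)‖ ≤ ε` for `‖x‖ ≥ R(ε)√(−t)` — the tree's
  `…SymmetricLiouville.rssFarFieldVanishing` (KNSS blow-down of the periodic leaf) transported to the column's `IsScrewAbout` objects.

CONSEQUENCE FOR STAFFING (numbers, not adjectives): the column's ONLY research hand H1 (`stub_noPinnedScrewSoliton` of LINE 29/30) is
implied by stmt-4053's registered open core; its general (non-poloidal, unpinned) form is Pineau–Vicol Conj. 1.1-hard («for bounded
profiles every α ≠ 0 is open», Disproof.lean §(c)); what H1 has IN ADDITION and any attack must use: e₂-POLOIDALITY of the profile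
(`Pinned` clause 5), the PIN (clauses 6–9), the FAST HALF already proved (|α| > α₀(C,B), LINE 29 §35), and now far-field vanishing.
LABELS: files-only; no item closed; 19708 / 20428 / 4053 OPEN; NS regularity NOT proved.
-/

noncomputable section

set_option linter.dupNamespace false
set_option linter.unusedVariables false

namespace Summit.NavierStokesRegularity.NavierStokesRegularity.Cruxes.PoloidalWindowRigidity.PointGroup.Rss

open scoped RealInnerProductSpace InnerProductSpace
open Set Function Filter Topology
open Literature.Analysis Literature.Analysis.FluidPDE
open Summit.NavierStokesRegularity.NavierStokesRegularity.Theorems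
open Summit.NavierStokesRegularity.NavierStokesRegularity.Theorems.PoloidalWindowDoorPoloidalWindowRigidityNearIdentityDefs

/-- Shorthand (reducible, notation only): physical space `ℝ³`. -/
abbrev E₃ : Type := EuclideanSpace ℝ (Fin 3)

/-! ## §1 Kinematics of the vertical rotations -/

theorem rotZ_smul_comm (θ c : ℝ) (v : E₃) : rotZ θ (c • v) = c • rotZ θ v := by
  ext i
  fin_cases i <;> simp <;> ring

theorem rotZ_rotZ_neg (θ : ℝ) (v : E₃) : rotZ θ (rotZ (-θ) v) = v := by
  rw [← rotZ_add, add_neg_cancel, rotZ_zero]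

/-- `d/dμ|_{μ=1} R_{α log μ} z = α • J z`. -/
theorem hasDerivAt_rotZ_log (α : ℝ) (z : E₃) :
    HasDerivAt (fun μ : ℝ => rotZ (α * Real.log μ) z) (α • rotGen z) 1 := by
  have hθ : HasDerivAt (fun μ : ℝ => α * Real.log μ) (α * 1⁻¹) 1 :=
    (Real.hasDerivAt_log one_ne_zero).const_mul α
  have hR := hasDerivAt_rotZ z (α * Real.log 1)
  have h := hR.scomp (1 : ℝ) hθ
  refine h.congr_deriv ?_
  rw [Real.log_one, mul_zero, Real.sin_zero, Real.cos_zero, inv_one, mul_one, neg_zero, zero_smul, zero_add, one_smul]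

/-- `J` is skew. -/
theorem inner_smul_rotGenL_self (α : ℝ) (x : E₃) : ⟪(α • rotGenL) x, x⟫_ℝ = 0 := by
  rw [show (α • rotGenL) x = α • rotGen x from rfl, inner_smul_left, inner_rotGen_self, mul_zero]

/-- `α • J ≠ 0` for `α ≠ 0`. -/
theorem smul_rotGenL_ne_zero {α : ℝ} (hα : α ≠ 0) : (α • rotGenL : E₃ →L[ℝ] E₃) ≠ 0 := by
  intro h
  have h1 := congrArg (fun T : E₃ →L[ℝ] E₃ => T (EuclideanSpace.single 0 1) 1) h
  simp [rotGen] at h1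
  exact hα h1

/-! ## §2 The generator clause of a screw-scaling soliton (PROVED) -/

/-- Derivative of the soliton orbit `μ ↦ μ • w(μ²t, μ • R_{α log μ} x)` at `μ = 1` for a jointly differentiable field. -/
theorem hasDerivAt_orbit {w : ℝ → E₃ → E₃} {t : ℝ} {x : E₃} {L : ℝ × E₃ →L[ℝ] E₃}
    (hL : HasFDerivAt (uncurry w) L (t, x)) (α : ℝ) :
    HasDerivAt (fun μ : ℝ => μ • w (μ ^ 2 * t) (μ • rotZ (α * Real.log μ) x))
      (fderiv ℝ (w t) x (x + (α • rotGenL) x) + w t x + (2 * t) • timeDeriv w t x) 1 := by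
  have hc1 : HasDerivAt (fun m : ℝ => m ^ 2 * t) (2 * t) 1 := by
    simpa using (hasDerivAt_pow 2 (1 : ℝ)).mul_const t
  have hc2 : HasDerivAt (fun m : ℝ => m • rotZ (α * Real.log m) x) (x + (α • rotGenL) x) 1 := by
    have h2 : HasDerivAt (fun m : ℝ => m • rotZ (α * Real.log m) x)
        ((1 : ℝ) • (α • rotGen x) + (1 : ℝ) • rotZ (α * Real.log 1) x) 1 :=
      (hasDerivAt_id' (1 : ℝ)).smul (hasDerivAt_rotZ_log α x)
    refine h2.congr_deriv ?_
    rw [one_smul, one_smul, Real.log_one, mul_zero, rotZ_zero, add_comm]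
    rfl
  have hc : HasDerivAt (fun m : ℝ => ((m ^ 2 * t, m • rotZ (α * Real.log m) x) : ℝ × E₃))
      ((2 * t, x + (α • rotGenL) x) : ℝ × E₃) 1 := hc1.prodMk hc2
  have hd : HasFDerivAt (uncurry w) L (((1 : ℝ) ^ 2 * t, (1 : ℝ) • rotZ (α * Real.log 1) x) : ℝ × E₃) := by
    rw [one_pow, one_mul, Real.log_one, mul_zero, rotZ_zero, one_smul]
    exact hL
  have hcomp := hd.comp_hasDerivAt (1 : ℝ) hc
  have hg : HasDerivAt (fun μ : ℝ => μ • w (μ ^ 2 * t) (μ • rotZ (α * Real.log μ) x))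
      ((1 : ℝ) • L ((2 * t, x + (α • rotGenL) x) : ℝ × E₃)
        + (1 : ℝ) • w ((1 : ℝ) ^ 2 * t) ((1 : ℝ) • rotZ (α * Real.log 1) x)) 1 :=
    (hasDerivAt_id' (1 : ℝ)).smul hcomp
  refine hg.congr_deriv ?_
  have hsplit : ((2 * t, x + (α • rotGenL) x) : ℝ × E₃) =
      (2 * t) • ((1 : ℝ), (0 : E₃)) + ((0 : ℝ), x + (α • rotGenL) x) := by
    ext <;> simp
  have e1 : timeDeriv w t x = L (1, 0) := (hasDerivAt_timeLine hL).deriv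
  have e2 : fderiv ℝ (w t) x (x + (α • rotGenL) x) = L (0, x + (α • rotGenL) x) := by
    rw [(hasFDerivAt_slice hL).fderiv]
    rfl
  rw [hsplit, map_add, map_smul, ← e1, ← e2, one_smul, one_smul, one_pow, one_mul, Real.log_one, mul_zero, rotZ_zero, one_smul]
  abel

/-- **THE GENERATOR CLAUSE OF A SCREW-SCALING SOLITON (PROVED).**  A field jointly `C¹` on the open past which is a one-parameter
screw-scaling soliton about the vertical axis through the origin, `IsScrew (α σ) (e^σ) w` for all `σ`, is annihilated by the rotated
scaling generator with `A = α • J`: `∇w·(x + Ax) + w + 2t ∂ₜw − Aw = 0` on `t < 0` — the symmetry clause of the crux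
`SymmetricLiouville` (stmt-4053) with `ξ = (0, 1, αJ)`. -/
theorem clause_of_screwSoliton {w : ℝ → E₃ → E₃} (hd : DifferentiableOn ℝ (uncurry w) (Iio (0 : ℝ) ×ˢ univ)) {α : ℝ}
    (hsol : ∀ σ : ℝ, IsScrew (α * σ) (Real.exp σ) w) :
    ∀ t < 0, ∀ x, fderiv ℝ (w t) x (x + (α • rotGenL) x) + w t x + (2 * t) • timeDeriv w t x - (α • rotGenL) (w t x) = 0 := by
  intro t ht x
  -- joint differentiability at the interior point `(t, x)`
  have hmem : ((t, x) : ℝ × E₃) ∈ Iio (0 : ℝ) ×ˢ (univ : Set E₃) := mk_mem_prod ht (mem_univ x)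
  have hL : HasFDerivAt (uncurry w) (fderiv ℝ (uncurry w) (t, x)) (t, x) :=
    ((hd (t, x) hmem).differentiableAt ((isOpen_Iio.prod isOpen_univ).mem_nhds hmem)).hasFDerivAt
  -- the invariance identity along `μ > 0`: `R_{α log μ} w(t,x) = μ • w(μ²t, μ • R_{α log μ} x)`
  have hinv : ∀ μ : ℝ, 0 < μ → rotZ (α * Real.log μ) (w t x) = μ • w (μ ^ 2 * t) (μ • rotZ (α * Real.log μ) x) := by
    intro μ hμ
    have h := hsol (Real.log μ) t ht x
    rw [Real.exp_log hμ] at h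
    rw [h, rotZ_smul_comm, rotZ_rotZ_neg]
  have h1 : HasDerivAt (fun μ : ℝ => rotZ (α * Real.log μ) (w t x)) (α • rotGen (w t x)) 1 := hasDerivAt_rotZ_log α (w t x)
  have h2 := hasDerivAt_orbit hL α
  have heq : (fun μ : ℝ => μ • w (μ ^ 2 * t) (μ • rotZ (α * Real.log μ) x)) =ᶠ[𝓝 1]
      (fun μ : ℝ => rotZ (α * Real.log μ) (w t x)) :=
    eventuallyEq_of_mem (Ioi_mem_nhds one_pos) fun μ hμ => (hinv μ hμ).symm
  have key := (h1.congr_of_eventuallyEq heq).unique h2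
  rw [sub_eq_zero, ← key]
  rfl

/-! ## §3 H1 at class level, and its three named dominators -/

/-- **H1, CLASS LEVEL** — no rotating scaling soliton in the Type-I ancient mild class: an element of `A_C` which is a one-parameter
screw-scaling soliton of nonzero angular speed about some vertical axis vanishes on the past.  (LINE 30's pinned hand
`NoPinnedScrewSoliton` is the special case of PINNED, e₂-POLOIDAL profiles; research; NOT proved here.) -/
def NoScrewSolitonClass : Prop :=
  ∀ (C α : ℝ), α ≠ 0 → ∀ (v : ℝ → E₃ → E₃) (c : E₃), IsTypeIAncientMild C v →
    (∀ σ : ℝ, IsScrewAbout c (α * σ) (Real.exp σ) v) → ∀ t < 0, ∀ x, v t x = 0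

/-- **The bounded-profile rotated-self-similar Liouville statement** — VERBATIM the hypothesis `hRSS` of
`Theorems.SymmetryModuliCountSymmetricLiouville.spiralScalingLiouville_of_rss` (= `Cruxes/SymmetricLiouville/Disproof.RotatedSelfSimilarLiouville`,
the registered OPEN core of stmt-NavierStokesRegularity-4053). -/
def RssLiouville : Prop :=
  ∀ (C : ℝ) (u : ℝ → E₃ → E₃), IsTypeIAncientMild C u →
    ∀ A : E₃ →L[ℝ] E₃, (∀ x, ⟪A x, x⟫_ℝ = 0) → A ≠ 0 →
      (∀ t < 0, ∀ x, fderiv ℝ (u t) x (x + A x) + u t x + (2 * t) • timeDeriv u t x - A (u t x) = 0) →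
      ∀ t < 0, ∀ x, u t x = 0

/-- **The NARROWED core** — VERBATIM the hypothesis `hCore` of `…SymmetricLiouville.rotatedSelfSimilarLiouville_of_core` (RSS Liouville for
elements whose scale-invariant size is small far from the centre; registered stub `stub_rssLiouvilleOfFarField`). -/
def RssCore : Prop :=
  ∀ (C : ℝ) (u : ℝ → E₃ → E₃), IsTypeIAncientMild C u →
    ∀ A : E₃ →L[ℝ] E₃, (∀ x, ⟪A x, x⟫_ℝ = 0) → A ≠ 0 →
      (∀ t < 0, ∀ x, fderiv ℝ (u t) x (x + A x) + u t x + (2 * t) • timeDeriv u t x - A (u t x) = 0) →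
      (∀ ε > 0, ∃ R : ℝ, ∀ t < 0, ∀ x, R * Real.sqrt (-t) ≤ ‖x‖ → Real.sqrt (-t) * ‖u t x‖ ≤ ε) →
      ∀ t < 0, ∀ x, u t x = 0

/-- **H1 (class level) ⇐ RSS LIOUVILLE (PROVED reduction).** -/
theorem noScrewSolitonClass_of_rss (hRSS : RssLiouville) : NoScrewSolitonClass := by
  intro C α hα v c hcl hsol
  set w : ℝ → E₃ → E₃ := fun t x => v t (x + c) with hw
  have hwcl : IsTypeIAncientMild C w := hcl.comp_add_right c
  have hd : DifferentiableOn ℝ (uncurry w) (Iio (0 : ℝ) ×ˢ univ) := hwcl.1.differentiableOn (by simp)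
  have hcl' := clause_of_screwSoliton hd (α := α) hsol
  have hz := hRSS C w hwcl (α • rotGenL) (inner_smul_rotGenL_self α) (smul_rotGenL_ne_zero hα) hcl'
  intro t ht x
  have := hz t ht (x - c)
  simpa [hw] using this

/-- **H1 (class level) ⇐ the NARROWED core** (`…rotatedSelfSimilarLiouville_of_core`: far-field vanishing is free). -/
theorem noScrewSolitonClass_of_core (hCore : RssCore) : NoScrewSolitonClass :=
  noScrewSolitonClass_of_rss fun C u hu A hA hA0 hL =>
    SymmetryModuliCountSymmetricLiouville.rotatedSelfSimilarLiouville_of_core hCore C u hu A hA hA0 hL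

/-- **H1 (class level) ⇐ the crux `SymmetricLiouville` (stmt-NavierStokesRegularity-4053) BY NAME.** -/
theorem noScrewSolitonClass_of_symmetricLiouville
    (hSL : Summit.NavierStokesRegularity.NavierStokesRegularity.Theses.SymmetryModuliCount.SymmetricLiouville) :
    NoScrewSolitonClass :=
  noScrewSolitonClass_of_rss fun C u hcl A hA hA0 hL =>
    hSL C u (isTypeIAncientMild_iff.1 hcl) 0 1 A hA (fun hz => one_ne_zero hz.2.1) fun s hs y => by
      simpa only [zero_add, one_smul, mul_one] using hL s hs y

/-! ## §4 FREE DATUM for H1: soliton profiles vanish at infinity (PROVED, unconditional) -/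

/-- **FAR FIELD OF A SCREW-SCALING SOLITON (PROVED, unconditional).**  The profile of a one-parameter screw-scaling soliton of `A_C`
about the vertical axis through `c` (any angular speed, `α = 0` = continuously self-similar allowed) is small far from the centre
in the scale-invariant sense: `√(−t)‖v(t, c + x)‖ ≤ ε` whenever `‖x‖ ≥ R(ε)√(−t)` — `…SymmetricLiouville.rssFarFieldVanishing`
(KNSS blow-down of the periodic leaf) on the translate, through `clause_of_screwSoliton`. -/
theorem screwSoliton_farField {C α : ℝ} {v : ℝ → E₃ → E₃} {c : E₃} (hcl : IsTypeIAncientMild C v)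
    (hsol : ∀ σ : ℝ, IsScrewAbout c (α * σ) (Real.exp σ) v) :
    ∀ ε > 0, ∃ R : ℝ, ∀ t < 0, ∀ x, R * Real.sqrt (-t) ≤ ‖x‖ → Real.sqrt (-t) * ‖v t (x + c)‖ ≤ ε := by
  have hwcl : IsTypeIAncientMild C (fun t x => v t (x + c)) := hcl.comp_add_right c
  have hd : DifferentiableOn ℝ (uncurry fun t x => v t (x + c)) (Iio (0 : ℝ) ×ˢ univ) := hwcl.1.differentiableOn (by simp)
  exact SymmetryModuliCountSymmetricLiouville.rssFarFieldVanishing C _ hwcl (α • rotGenL) (inner_smul_rotGenL_self α)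
    (clause_of_screwSoliton hd (α := α) hsol)

/-! ## §5 THE CONVERSE (PROVED): the clause integrates back to the screw-scaling group — class-level H1 IS the vertical-axis core

The generator clause with `A = α • J` is not merely implied by the screw-scaling symmetry: along every orbit
`σ ↦ (e^{2σ} t, e^σ R_{ασ} x)` the rotated-rescaled value `O(σ) = e^σ R_{−ασ} w(e^{2σ}t, e^σ R_{ασ} x)` has derivative
`e^{σ} R_{−ασ}(clause at the moved point) = 0`, so `O(σ) = O(0) = w(t, x)` — the field IS a screw-scaling soliton.  Hence
`NoScrewSolitonClass ↔ RssLiouvilleVertical` (the open core of stmt-4053 for VERTICAL axes); the general axis is the tree's axis normal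
form (`Theorems.solitonBridge_axisNormalForm`: conjugation by a linear isometry, `exists_conj_eq_smul_rotGen` + class covariance
`SymmetryModuliCountSymmetricLiouville.stub_rotationCovariance`; its generator-covariance lemma is `private` there — re-export wanted, not
re-typed here). -/

/-- Rodrigues' formula `R_θ = 1 + sin θ • J + (1 − cos θ) • J²` (re-proved; tree `…FilamentSkeletonRssKelvinGateOUKernel.rotZL_eq_rodrigues`
is not importable from a workfile cheaply). -/
theorem rotZL_rodrigues (θ : ℝ) :
    rotZL θ = 1 + Real.sin θ • rotGenL + (1 - Real.cos θ) • rotGenL.comp rotGenL := by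
  ext v i
  fin_cases i <;> simp [rotGen] <;> ring

/-- The operator-valued derivative `d/dμ|_{μ=1} R_{−α log μ} = −α J`. -/
theorem hasDerivAt_rotZL_neg_log (α : ℝ) :
    HasDerivAt (fun μ : ℝ => rotZL (-(α * Real.log μ))) (-(α • rotGenL) : E₃ →L[ℝ] E₃) 1 := by
  have hθ : HasDerivAt (fun μ : ℝ => -(α * Real.log μ)) (-(α * 1⁻¹)) 1 :=
    ((Real.hasDerivAt_log one_ne_zero).const_mul α).neg
  have hs : HasDerivAt (fun μ : ℝ => Real.sin (-(α * Real.log μ)))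
      (Real.cos (-(α * Real.log 1)) * -(α * 1⁻¹)) 1 := (Real.hasDerivAt_sin _).comp 1 hθ
  have hc : HasDerivAt (fun μ : ℝ => 1 - Real.cos (-(α * Real.log μ)))
      (0 - -Real.sin (-(α * Real.log 1)) * -(α * 1⁻¹)) 1 :=
    (hasDerivAt_const (1 : ℝ) (1 : ℝ)).sub ((Real.hasDerivAt_cos _).comp 1 hθ)
  have hfun : (fun μ : ℝ => rotZL (-(α * Real.log μ))) = fun μ =>
      (1 : E₃ →L[ℝ] E₃) + Real.sin (-(α * Real.log μ)) • rotGenL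
        + (1 - Real.cos (-(α * Real.log μ))) • rotGenL.comp rotGenL := by
    funext μ; exact rotZL_rodrigues _
  rw [hfun]
  refine (((hasDerivAt_const (1 : ℝ) (1 : E₃ →L[ℝ] E₃)).add (hs.smul_const _)).add (hc.smul_const _)).congr_deriv ?_
  simp [neg_smul]

/-- The orbit WITH the outer counter-rotation, `μ ↦ R_{−α log μ}(μ • w(μ²t, μ • R_{α log μ} x))`, has derivative at `μ = 1` the FULL
generator clause `∇w·(x + Ax) + w + 2t ∂ₜw − Aw`, `A = α • J`. -/
theorem hasDerivAt_orbit_rot {w : ℝ → E₃ → E₃} {t : ℝ} {x : E₃} {L : ℝ × E₃ →L[ℝ] E₃}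
    (hL : HasFDerivAt (uncurry w) L (t, x)) (α : ℝ) :
    HasDerivAt (fun μ : ℝ => rotZL (-(α * Real.log μ)) (μ • w (μ ^ 2 * t) (μ • rotZ (α * Real.log μ) x)))
      (fderiv ℝ (w t) x (x + (α • rotGenL) x) + w t x + (2 * t) • timeDeriv w t x - (α • rotGenL) (w t x)) 1 := by
  refine ((hasDerivAt_rotZL_neg_log α).clm_apply (hasDerivAt_orbit hL α)).congr_deriv ?_
  rw [one_pow, one_mul, Real.log_one, mul_zero, neg_zero, rotZ_zero, one_smul, one_smul, rotZL_apply, rotZ_zero,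
    _root_.neg_apply]
  abel

/-- The rotated-rescaled orbit value `O_{t,x}(σ) = e^σ • R_{−ασ} w(e^{2σ} t, e^σ • R_{ασ} x)`. -/
def orbitVal (α : ℝ) (w : ℝ → E₃ → E₃) (t : ℝ) (x : E₃) (σ : ℝ) : E₃ :=
  Real.exp σ • rotZ (-(α * σ)) (w (Real.exp σ ^ 2 * t) (Real.exp σ • rotZ (α * σ) x))

theorem orbitVal_zero (α : ℝ) (w : ℝ → E₃ → E₃) (t : ℝ) (x : E₃) : orbitVal α w t x 0 = w t x := by
  simp [orbitVal]

/-- The group law along the orbit: shifting `σ` by `σ₀` is the orbit of the MOVED point, counter-rotated and rescaled. -/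
theorem orbitVal_add (α : ℝ) (w : ℝ → E₃ → E₃) (t : ℝ) (x : E₃) (σ₀ s : ℝ) :
    orbitVal α w t x (σ₀ + s) = Real.exp σ₀ • rotZ (-(α * σ₀))
      (orbitVal α w (Real.exp σ₀ ^ 2 * t) (Real.exp σ₀ • rotZ (α * σ₀) x) s) := by
  unfold orbitVal
  have e1 : Real.exp (σ₀ + s) ^ 2 * t = Real.exp s ^ 2 * (Real.exp σ₀ ^ 2 * t) := by
    rw [Real.exp_add]; ring
  have e2 : Real.exp (σ₀ + s) • rotZ (α * (σ₀ + s)) x = Real.exp s • rotZ (α * s) (Real.exp σ₀ • rotZ (α * σ₀) x) := by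
    rw [rotZ_smul_comm, smul_smul, Real.exp_add, mul_comm (Real.exp σ₀), mul_add, add_comm, rotZ_add]
  have e3 : ∀ q : E₃, rotZ (-(α * (σ₀ + s))) q = rotZ (-(α * σ₀)) (rotZ (-(α * s)) q) := fun q => by
    rw [show -(α * (σ₀ + s)) = -(α * σ₀) + -(α * s) by ring, rotZ_add]
  rw [e1, e2, e3, rotZ_smul_comm, smul_smul, Real.exp_add]
  rw [rotZ_smul_comm (-(α * σ₀)) (Real.exp s), smul_smul]

/-- Along the orbit of a point of the open past, `O_{t,x}` is the exponential reparametrisation of the `μ`-orbit of §2. -/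
theorem orbitVal_eq_exp (α : ℝ) (w : ℝ → E₃ → E₃) (t : ℝ) (x : E₃) (s : ℝ) :
    orbitVal α w t x s = (fun μ : ℝ => rotZL (-(α * Real.log μ)) (μ • w (μ ^ 2 * t) (μ • rotZ (α * Real.log μ) x))) (Real.exp s) := by
  simp only [orbitVal, Real.log_exp, rotZL_apply, rotZ_smul_comm]

/-- **THE CLAUSE INTEGRATES (PROVED).**  A field jointly `C¹` on the open past annihilated by the rotated scaling generator with `A = α • J`
is a one-parameter screw-scaling soliton about the vertical axis through the origin: `IsScrew (ασ) (e^σ) w` for every `σ`. -/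
theorem screwSoliton_of_clause {w : ℝ → E₃ → E₃} (hd : DifferentiableOn ℝ (uncurry w) (Iio (0 : ℝ) ×ˢ univ)) {α : ℝ}
    (hcl : ∀ t < 0, ∀ x, fderiv ℝ (w t) x (x + (α • rotGenL) x) + w t x + (2 * t) • timeDeriv w t x - (α • rotGenL) (w t x) = 0) :
    ∀ σ : ℝ, IsScrew (α * σ) (Real.exp σ) w := by
  -- derivative of the orbit value at `s = 0`, at ANY point of the open past: the clause there
  have hder0 : ∀ t < 0, ∀ x, HasDerivAt (orbitVal α w t x) 0 0 := by
    intro t ht x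
    have hmem : ((t, x) : ℝ × E₃) ∈ Iio (0 : ℝ) ×ˢ (univ : Set E₃) := mk_mem_prod ht (mem_univ x)
    have hL : HasFDerivAt (uncurry w) (fderiv ℝ (uncurry w) (t, x)) (t, x) :=
      ((hd (t, x) hmem).differentiableAt ((isOpen_Iio.prod isOpen_univ).mem_nhds hmem)).hasFDerivAt
    have hP := hasDerivAt_orbit_rot hL α
    rw [hcl t ht x] at hP
    have hP' : HasDerivAt (fun μ : ℝ => rotZL (-(α * Real.log μ)) (μ • w (μ ^ 2 * t) (μ • rotZ (α * Real.log μ) x)))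
        0 (Real.exp 0) := by rwa [Real.exp_zero]
    have hcomp := hP'.scomp (0 : ℝ) (Real.hasDerivAt_exp 0)
    rw [smul_zero] at hcomp
    refine hcomp.congr_of_eventuallyEq (Eventually.of_forall fun s => ?_)
    exact orbitVal_eq_exp α w t x s
  -- derivative zero at EVERY `σ₀`, by the group law
  have hder : ∀ t < 0, ∀ x, ∀ σ₀, HasDerivAt (orbitVal α w t x) 0 σ₀ := by
    intro t ht x σ₀
    have ht' : Real.exp σ₀ ^ 2 * t < 0 := mul_neg_of_pos_of_neg (pow_pos (Real.exp_pos σ₀) 2) ht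
    have h0 := hder0 _ ht' (Real.exp σ₀ • rotZ (α * σ₀) x)
    -- reparametrise `σ = σ₀ + s`
    have h1 : HasDerivAt (fun σ => orbitVal α w (Real.exp σ₀ ^ 2 * t) (Real.exp σ₀ • rotZ (α * σ₀) x) (σ - σ₀))
        ((0 : E₃)) σ₀ := by
      have h0' : HasDerivAt (orbitVal α w (Real.exp σ₀ ^ 2 * t) (Real.exp σ₀ • rotZ (α * σ₀) x)) 0 (σ₀ - σ₀) := by
        rwa [sub_self]
      exact h0'.comp_sub_const σ₀ σ₀
    have h2 : HasDerivAt (fun σ => Real.exp σ₀ • rotZL (-(α * σ₀))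
        (orbitVal α w (Real.exp σ₀ ^ 2 * t) (Real.exp σ₀ • rotZ (α * σ₀) x) (σ - σ₀))) (Real.exp σ₀ • rotZL (-(α * σ₀)) 0) σ₀ :=
      ((rotZL (-(α * σ₀))).hasFDerivAt.comp_hasDerivAt σ₀ h1).const_smul (Real.exp σ₀)
    rw [map_zero, smul_zero] at h2
    refine h2.congr_of_eventuallyEq (Eventually.of_forall fun σ => ?_)
    have := orbitVal_add α w t x σ₀ (σ - σ₀)
    rw [add_sub_cancel] at this
    simpa only [rotZL_apply] using this
  -- hence the orbit value is constant, equal to its value `w t x` at `σ = 0`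
  intro σ t ht x
  have hdiff : Differentiable ℝ (orbitVal α w t x) := fun σ₀ => (hder t ht x σ₀).differentiableAt
  have hconst := is_const_of_deriv_eq_zero hdiff (fun σ₀ => (hder t ht x σ₀).deriv) σ 0
  rw [orbitVal_zero] at hconst
  rw [← hconst]
  rfl

/-- **The vertical-axis core**: the open core `RssLiouville` of stmt-4053 restricted to skew parts `A = α • J`, `α ≠ 0`. -/
def RssLiouvilleVertical : Prop :=
  ∀ (C α : ℝ), α ≠ 0 → ∀ (u : ℝ → E₃ → E₃), IsTypeIAncientMild C u →
    (∀ t < 0, ∀ x, fderiv ℝ (u t) x (x + (α • rotGenL) x) + u t x + (2 * t) • timeDeriv u t x - (α • rotGenL) (u t x) = 0) →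
    ∀ t < 0, ∀ x, u t x = 0

theorem rssLiouvilleVertical_of_rss (hRSS : RssLiouville) : RssLiouvilleVertical :=
  fun C α hα u hu hcl => hRSS C u hu (α • rotGenL) (inner_smul_rotGenL_self α) (smul_rotGenL_ne_zero hα) hcl

/-- **CLASS-LEVEL H1 ≡ THE VERTICAL-AXIS CORE OF stmt-4053 (PROVED equivalence).** -/
theorem noScrewSolitonClass_iff_rssLiouvilleVertical : NoScrewSolitonClass ↔ RssLiouvilleVertical := by
  constructor
  · intro hH C α hα u hu hcl
    have hd : DifferentiableOn ℝ (uncurry u) (Iio (0 : ℝ) ×ˢ univ) := hu.1.differentiableOn (by simp)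
    have hsol := screwSoliton_of_clause hd hcl
    refine hH C α hα u 0 hu fun σ => ?_
    have h0 : (fun t x => u t (x + 0)) = u := by simp
    show IsScrew (α * σ) (Real.exp σ) (fun t x => u t (x + 0))
    rw [h0]
    exact hsol σ
  · intro hV C α hα v c hcl hsol
    set w : ℝ → E₃ → E₃ := fun t x => v t (x + c) with hw
    have hwcl : IsTypeIAncientMild C w := hcl.comp_add_right c
    have hd : DifferentiableOn ℝ (uncurry w) (Iio (0 : ℝ) ×ˢ univ) := hwcl.1.differentiableOn (by simp)
    have hz := hV C α hα w hwcl (clause_of_screwSoliton hd (α := α) hsol)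
    intro t ht x
    have := hz t ht (x - c)
    simpa [hw] using this

/-! ## §6 The general axis (PROVED): conjugation by a linear isometry — class-level H1 ≡ the FULL open core `RssLiouville` of stmt-4053

Generator covariance under `u ↦ L u L⁻¹` (re-proved after the `private` lemmas of `Theorems/TypeICertificateLadderTargetSolitonBridgeNormalForm`),
the skew normal form `exists_conj_eq_smul_rotGen` (tree) and class covariance `isTypeIAncientMild_conj_linearIsometryEquiv` (tree). -/

theorem fderiv_conj_apply (L : E₃ ≃ₗᵢ[ℝ] E₃) {φ : E₃ → E₃} (hd : Differentiable ℝ φ) (y h : E₃) :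
    fderiv ℝ (fun z => L (φ (L.symm z))) y h = L (fderiv ℝ φ (L.symm y) (L.symm h)) := by
  have hC : HasFDerivAt (fun z : E₃ => L z) (L.toContinuousLinearEquiv : E₃ →L[ℝ] E₃) (φ (L.symm y)) :=
    L.toContinuousLinearEquiv.hasFDerivAt
  have hcomp : HasFDerivAt (fun z => L (φ (L.symm z)))
      ((L.toContinuousLinearEquiv : E₃ →L[ℝ] E₃).comp ((fderiv ℝ φ (L.symm y)).comp
        (L.symm.toContinuousLinearEquiv : E₃ →L[ℝ] E₃))) y :=
    (hC.comp (L.symm y) (hd _).hasFDerivAt).comp y L.symm.toContinuousLinearEquiv.hasFDerivAt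
  rw [hcomp.fderiv]
  rfl

theorem timeDeriv_conj {C : ℝ} {u : ℝ → E₃ → E₃} (hu : IsTypeIAncientMild C u) (L : E₃ ≃ₗᵢ[ℝ] E₃) {t : ℝ} (ht : t < 0) (x : E₃) :
    timeDeriv (fun s y => L (u s (L.symm y))) t x = L (timeDeriv u t (L.symm x)) := by
  rw [timeDeriv_apply, timeDeriv_apply]
  have h1 : ContDiffAt ℝ (⊤ : ℕ∞) (uncurry u) (t, L.symm x) :=
    hu.contDiffOn.contDiffAt ((isOpen_Iio.prod isOpen_univ).mem_nhds ⟨ht, mem_univ _⟩)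
  have h2 : ContDiffAt ℝ (⊤ : ℕ∞) (fun r : ℝ => (r, L.symm x)) t := (contDiff_id.prodMk contDiff_const).contDiffAt
  have hda0 : DifferentiableAt ℝ (uncurry u ∘ fun r : ℝ => (r, L.symm x)) t :=
    (h1.comp t h2).differentiableAt (by simp)
  have hda : DifferentiableAt ℝ (fun s => u s (L.symm x)) t := hda0
  have hd : HasDerivAt (fun s => u s (L.symm x)) (deriv (fun s => u s (L.symm x)) t) t := hda.hasDerivAt
  have hC : HasFDerivAt (fun z : E₃ => L z) (L.toContinuousLinearEquiv : E₃ →L[ℝ] E₃) (u t (L.symm x)) :=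
    L.toContinuousLinearEquiv.hasFDerivAt
  exact (hC.comp_hasDerivAt t hd).deriv

/-- Covariance of the rotated scaling generator under a conjugating isometry with `L A L⁻¹ = β J`. -/
theorem clause_conj {C : ℝ} {u : ℝ → E₃ → E₃} (hu : IsTypeIAncientMild C u) (L : E₃ ≃ₗᵢ[ℝ] E₃)
    {A : E₃ →L[ℝ] E₃} {β : ℝ} (hconj : ∀ y, L (A (L.symm y)) = β • rotGen y) {t : ℝ} (ht : t < 0) (x : E₃)
    (hgen : fderiv ℝ (u t) (L.symm x) (L.symm x + A (L.symm x)) + u t (L.symm x) +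
      (2 * t) • timeDeriv u t (L.symm x) - A (u t (L.symm x)) = 0) :
    fderiv ℝ (fun y => L (u t (L.symm y))) x (x + (β • rotGenL) x) + L (u t (L.symm x)) +
      (2 * t) • timeDeriv (fun s y => L (u s (L.symm y))) t x - (β • rotGenL) (L (u t (L.symm x))) = 0 := by
  have hd : Differentiable ℝ (u t) := (hu.contDiff_slice ht).differentiable (by simp)
  have e1 : ∀ w : E₃, (β • rotGenL) w = β • rotGen w := fun w => rfl
  have e2 : L.symm (β • rotGen x) = A (L.symm x) := by
    apply L.injective
    rw [L.apply_symm_apply, hconj x]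
  have e3 : β • rotGen (L (u t (L.symm x))) = L (A (u t (L.symm x))) := by
    rw [← hconj, L.symm_apply_apply]
  rw [fderiv_conj_apply L hd, map_add L.symm, e1 x, e2, timeDeriv_conj hu L ht, e1, e3, ← L.map_smul, ← map_add, ← map_add,
    ← map_sub, hgen, map_zero]

/-- **THE FULL CORE FROM THE VERTICAL ONE (PROVED)**: `RssLiouvilleVertical → RssLiouville`. -/
theorem rss_of_rssLiouvilleVertical (hV : RssLiouvilleVertical) : RssLiouville := by
  intro C u hu A hA hA0 hcl
  obtain ⟨L, β, hβ, hconj⟩ := AxisymEndLiouville.AbsorbingAxisSwirlExtinction.exists_conj_eq_smul_rotGen hA hA0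
  have hcu : IsTypeIAncientMild C (fun t x => L (u t (L.symm x))) :=
    SymmetryModuliCountSymmetricLiouville.isTypeIAncientMild_conj_linearIsometryEquiv hu L
  have hz := hV C β hβ _ hcu fun t ht x => clause_conj hu L hconj ht x (hcl t ht (L.symm x))
  intro t ht x
  have h := hz t ht (L x)
  rw [L.symm_apply_apply] at h
  exact (map_eq_zero_iff L L.injective).1 h

/-- **CLASS-LEVEL H1 ≡ THE OPEN CORE OF stmt-4053 (PROVED equivalence, all axes).** -/
theorem noScrewSolitonClass_iff_rssLiouville : NoScrewSolitonClass ↔ RssLiouville :=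
  ⟨fun h => rss_of_rssLiouvilleVertical (noScrewSolitonClass_iff_rssLiouvilleVertical.1 h), noScrewSolitonClass_of_rss⟩

end Summit.NavierStokesRegularity.NavierStokesRegularity.Cruxes.PoloidalWindowRigidity.PointGroup.Rss
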